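import Summits.PneNP.PneNP.Theorems.AeaCutRectanglesDutyRectangles

/-!
# FoolingMeasure (stmt-PneNP-19727) — design lemma L0: WLOG the fooling measure lives on 4-EDGE-CRITICAL edge sets

Crux `Summit.PneNP.PneNP.Theses.AeaCutRectangles.FoolingMeasure` (X1), route-PneNP-AeaCutRectangles;
crux-ideate round 2, seat 1, gen 14.  FRONTIER restricted-model rung (AEA cut rectangles); nothing here bears on P vs NP.

`foolingMeasure_iff_crit` : X1 ⟺ X1 with the support condition strengthened from "loopless and not
3-colourable" to "loopless, not 3-colourable, and every single-edge deletion 3-colourable" (`IsEdgeCritical`).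

Proof (pushforward along a core map).  Every loopless non-3-colourable `G` contains an edge-critical subset
(`exists_critical_subset`: a non-3-colourable subset of minimum cardinality); fix one, `core G ⊆ G`.  Push `μ`
forward along `core`.  In the DUTY FORM of X1 (`foolingMeasure_iff_duty`, Theorems/AeaCutRectanglesDutyRectangles)
a rectangle is `dutyRect B Φ` = "the inside-`B` edges kill every colouring in `Φ` and the edges meeting `V ∖ B`
kill every colouring outside `Φ`", which is MONOTONE under adding edges (`dutyRect_mono`); hence
`core G ∈ dutyRect B Φ → G ∈ dutyRect B Φ`, so every duty rectangle is at most as heavy under the pushforward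
as under `μ` (`dutySum_push_le`), and the pushforward inherits X1's bound with the same `ε`, `C`, `n`.

Design consequences (memo DESIGN-LEMMAS-r2s1g14.md): (i) "skeleton + decoration / free bulk" supports never help —
only the law of the critical core matters (this is the census' sub-fibre lemma (e)(i) made global); (ii) for
critical members both sides of every cut are automatically 3-colourable as soon as the member has an edge inside
`B` and an edge meeting `V ∖ B` (`IsEdgeCritical.colorable_of_ssubset`), so the one-sided kills
(p566481/p568326/p572693) are design constraints only through "every near-half spans an edge"; (iii) the
HalfSparseCore-type superset count applies with `F = G`.
-/

set_option linter.dupNamespace false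
set_option autoImplicit false

namespace Summit.PneNP.PneNP.Cruxes.FoolingMeasure.CriticalSupport

open Finset
open Summit.PneNP.PneNP.Theorems.AeaCutRectanglesDutyRectangles

/-- An edge set over `Fin n` is 4-EDGE-CRITICAL (for 3-colourability): loopless, not 3-colourable, and every
single-edge deletion is 3-colourable. -/
def IsEdgeCritical {n : ℕ} (S : Finset (Sym2 (Fin n))) : Prop :=
  (∀ e ∈ S, ¬ e.IsDiag) ∧ ¬ (SimpleGraph.fromEdgeSet (S : Set (Sym2 (Fin n)))).Colorable 3 ∧
    ∀ e ∈ S, (SimpleGraph.fromEdgeSet ((S.erase e : Finset (Sym2 (Fin n))) : Set (Sym2 (Fin n)))).Colorable 3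

/-- Every proper subset of an edge-critical set is 3-colourable. -/
theorem IsEdgeCritical.colorable_of_ssubset {n : ℕ} {S T : Finset (Sym2 (Fin n))} (hS : IsEdgeCritical S)
    (hT : T ⊂ S) : (SimpleGraph.fromEdgeSet (T : Set (Sym2 (Fin n)))).Colorable 3 := by
  obtain ⟨e, heS, heT⟩ := Finset.exists_of_ssubset hT
  have hsub : (T : Set (Sym2 (Fin n))) ⊆ ((S.erase e : Finset (Sym2 (Fin n))) : Set (Sym2 (Fin n))) := by
    intro f hf
    have hfT : f ∈ T := hf
    have hfe : f ≠ e := fun h => heT (h ▸ hfT)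
    exact Finset.mem_coe.2 (Finset.mem_erase.2 ⟨hfe, hT.1 hfT⟩)
  exact (hS.2.2 e heS).mono_left (SimpleGraph.fromEdgeSet_mono hsub)

/-- Consequence (ii): for an edge-critical member, ALICE'S side over any cut is 3-colourable as soon as the
member has an edge inside `B` … -/
theorem IsEdgeCritical.aliceSide_colorable {n : ℕ} {S : Finset (Sym2 (Fin n))} (hS : IsEdgeCritical S)
    {B : Finset (Fin n)} (h : (bobSide B S).Nonempty) :
    (SimpleGraph.fromEdgeSet ((aliceSide B S : Finset (Sym2 (Fin n))) : Set (Sym2 (Fin n)))).Colorable 3 := by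
  obtain ⟨e, he⟩ := h
  obtain ⟨heS, hein⟩ := mem_bobSide.1 he
  refine hS.colorable_of_ssubset
    (Finset.ssubset_iff_subset_ne.2 ⟨fun f hf => (mem_aliceSide.1 hf).1, fun hEq => ?_⟩)
  have : e ∈ aliceSide B S := by rw [hEq]; exact heS
  obtain ⟨_, v, hv, hvB⟩ := mem_aliceSide.1 this
  exact hvB (hein v hv)

/-- … and BOB'S side is 3-colourable as soon as the member has an edge meeting `V ∖ B`. -/
theorem IsEdgeCritical.bobSide_colorable {n : ℕ} {S : Finset (Sym2 (Fin n))} (hS : IsEdgeCritical S)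
    {B : Finset (Fin n)} (h : (aliceSide B S).Nonempty) :
    (SimpleGraph.fromEdgeSet ((bobSide B S : Finset (Sym2 (Fin n))) : Set (Sym2 (Fin n)))).Colorable 3 := by
  obtain ⟨e, he⟩ := h
  obtain ⟨heS, v, hv, hvB⟩ := mem_aliceSide.1 he
  refine hS.colorable_of_ssubset
    (Finset.ssubset_iff_subset_ne.2 ⟨fun f hf => (mem_bobSide.1 hf).1, fun hEq => ?_⟩)
  have : e ∈ bobSide B S := by rw [hEq]; exact heS
  exact hvB ((mem_bobSide.1 this).2 v hv)

/-- Every loopless non-3-colourable edge set contains an edge-critical subset (a non-3-colourable subset of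
minimum cardinality). -/
theorem exists_critical_subset {n : ℕ} (S : Finset (Sym2 (Fin n))) (hl : ∀ e ∈ S, ¬ e.IsDiag)
    (hS : ¬ (SimpleGraph.fromEdgeSet (S : Set (Sym2 (Fin n)))).Colorable 3) :
    ∃ T, T ⊆ S ∧ IsEdgeCritical T := by
  classical
  set F : Finset (Finset (Sym2 (Fin n))) :=
    S.powerset.filter (fun T => ¬ (SimpleGraph.fromEdgeSet (T : Set (Sym2 (Fin n)))).Colorable 3) with hF
  have hSF : S ∈ F := Finset.mem_filter.2 ⟨Finset.mem_powerset.2 (subset_refl S), hS⟩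
  obtain ⟨T, hTF, hmin⟩ := F.exists_min_image Finset.card ⟨S, hSF⟩
  have hTS : T ⊆ S := Finset.mem_powerset.1 (Finset.mem_filter.1 hTF).1
  have hTnc : ¬ (SimpleGraph.fromEdgeSet (T : Set (Sym2 (Fin n)))).Colorable 3 := (Finset.mem_filter.1 hTF).2
  refine ⟨T, hTS, fun e he => hl e (hTS he), hTnc, fun e he => ?_⟩
  by_contra hc
  have hmem : T.erase e ∈ F :=
    Finset.mem_filter.2 ⟨Finset.mem_powerset.2 ((Finset.erase_subset e T).trans hTS), hc⟩
  have hle := hmin _ hmem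
  rw [Finset.card_erase_of_mem he] at hle
  have hpos : 0 < T.card := Finset.card_pos.2 ⟨e, he⟩
  omega

/-- The CORE MAP: an edge-critical subset of a loopless non-3-colourable edge set (and the identity elsewhere). -/
noncomputable def core {n : ℕ} (G : Finset (Sym2 (Fin n))) : Finset (Sym2 (Fin n)) := by
  classical
  exact if h : (∀ e ∈ G, ¬ e.IsDiag) ∧ ¬ (SimpleGraph.fromEdgeSet (G : Set (Sym2 (Fin n)))).Colorable 3
    then (exists_critical_subset G h.1 h.2).choose else G

theorem core_subset {n : ℕ} (G : Finset (Sym2 (Fin n))) : core G ⊆ G := by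
  classical
  unfold core
  split_ifs with h
  · exact (exists_critical_subset G h.1 h.2).choose_spec.1
  · exact subset_refl G

theorem core_critical {n : ℕ} (G : Finset (Sym2 (Fin n))) (hl : ∀ e ∈ G, ¬ e.IsDiag)
    (hG : ¬ (SimpleGraph.fromEdgeSet (G : Set (Sym2 (Fin n)))).Colorable 3) : IsEdgeCritical (core G) := by
  classical
  unfold core
  rw [dif_pos ⟨hl, hG⟩]
  exact (exists_critical_subset G hl hG).choose_spec.2

/-- Duty rectangles are monotone under adding (non-loop) edges. -/
theorem dutyRect_mono {n : ℕ} {B : Finset (Fin n)} {Φ : Set (Fin n → Fin 3)} {K G : Finset (Sym2 (Fin n))}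
    (hKG : K ⊆ G) (hGl : ∀ e ∈ G, ¬ e.IsDiag) (hK : K ∈ dutyRect B Φ) : G ∈ dutyRect B Φ := by
  obtain ⟨_, h1, h2⟩ := hK
  refine ⟨hGl, fun c hc => ?_, fun c hc => ?_⟩
  · obtain ⟨e, he, h⟩ := h1 c hc
    exact ⟨e, hKG he, h⟩
  · obtain ⟨e, he, h⟩ := h2 c hc
    exact ⟨e, hKG he, h⟩

/-- The PUSHFORWARD of `μ` along `core`. -/
noncomputable def push {n : ℕ} (μ : Finset (Sym2 (Fin n)) → ℝ) (T : Finset (Sym2 (Fin n))) : ℝ := by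
  classical
  exact ∑ G, if core G = T then μ G else 0

theorem push_nonneg {n : ℕ} (μ : Finset (Sym2 (Fin n)) → ℝ) (hμ : ∀ S, 0 ≤ μ S) (T : Finset (Sym2 (Fin n))) :
    0 ≤ push μ T := by
  classical
  unfold push
  exact Finset.sum_nonneg fun G _ => by split_ifs <;> simp [hμ G]

theorem push_total {n : ℕ} (μ : Finset (Sym2 (Fin n)) → ℝ) : ∑ T, push μ T = ∑ G, μ G := by
  classical
  unfold push
  rw [Finset.sum_comm]
  refine Finset.sum_congr rfl fun G _ => ?_
  rw [Finset.sum_ite_eq]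
  simp

theorem push_ne_zero {n : ℕ} (μ : Finset (Sym2 (Fin n)) → ℝ) {T : Finset (Sym2 (Fin n))} (hT : push μ T ≠ 0) :
    ∃ G, core G = T ∧ μ G ≠ 0 := by
  classical
  unfold push at hT
  obtain ⟨G, _, hG⟩ := Finset.exists_ne_zero_of_sum_ne_zero hT
  by_cases h : core G = T
  · rw [if_pos h] at hG
    exact ⟨G, h, hG⟩
  · rw [if_neg h] at hG
    exact absurd rfl hG

/-- **Pushforward monotonicity of duty masses**: if `μ` charges only loopless sets, every duty rectangle is at most
as heavy under `push μ` as under `μ` (because `core G ∈ dutyRect → G ∈ dutyRect`). -/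
theorem dutySum_push_le {n : ℕ} (μ : Finset (Sym2 (Fin n)) → ℝ) (hμ : ∀ S, 0 ≤ μ S)
    (hl : ∀ S, μ S ≠ 0 → ∀ e ∈ S, ¬ e.IsDiag) (B : Finset (Fin n)) (Φ : Set (Fin n → Fin 3)) :
    ∑ T ∈ dutyFinset B Φ, push μ T ≤ ∑ G ∈ dutyFinset B Φ, μ G := by
  classical
  have h1 : ∑ T ∈ dutyFinset B Φ, push μ T = ∑ G, if core G ∈ dutyFinset B Φ then μ G else 0 := by
    unfold push
    rw [Finset.sum_comm]
    refine Finset.sum_congr rfl fun G _ => ?_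
    rw [Finset.sum_ite_eq]
  have h2 : ∑ G ∈ dutyFinset B Φ, μ G = ∑ G, if G ∈ dutyFinset B Φ then μ G else 0 := by
    rw [Finset.sum_ite_mem, Finset.univ_inter]
  rw [h1, h2]
  refine Finset.sum_le_sum fun G _ => ?_
  by_cases hc : core G ∈ dutyFinset B Φ
  · rw [if_pos hc]
    by_cases hz : μ G = 0
    · rw [hz]; split_ifs <;> simp
    · have hG : G ∈ dutyFinset B Φ :=
        mem_dutyFinset.2 (dutyRect_mono (core_subset G) (hl G hz) (mem_dutyFinset.1 hc))
      rw [if_pos hG]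
  · rw [if_neg hc]; split_ifs <;> simp [hμ G]

/-- X1 with the support restricted to 4-edge-critical edge sets (otherwise verbatim). -/
def FoolingMeasureCrit : Prop :=
  ∃ ε : ℝ, 0 < ε ∧ ε ≤ 1 / 4 ∧ ∀ C : ℕ, ∃ᶠ n in Filter.atTop, ∃ μ : Finset (Sym2 (Fin n)) → ℝ,
    (∀ S, 0 ≤ μ S) ∧ (∑ S, μ S = 1) ∧ (∀ S, μ S ≠ 0 → IsEdgeCritical S) ∧
    ∀ B : Finset (Fin n), (1 / 2 - ε) * (n : ℝ) ≤ B.card → (B.card : ℝ) ≤ (1 / 2 + ε) * n →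
      ∀ 𝓐 𝓑 : Finset (Finset (Sym2 (Fin n))),
        (∀ α ∈ 𝓐, ∀ e ∈ α, ¬ e.IsDiag ∧ ∃ v ∈ e, v ∉ B) →
        (∀ β ∈ 𝓑, ∀ e ∈ β, ¬ e.IsDiag ∧ ∀ v ∈ e, v ∈ B) →
        (∀ α ∈ 𝓐, ∀ β ∈ 𝓑,
          ¬ (SimpleGraph.fromEdgeSet ((α ∪ β : Finset (Sym2 (Fin n))) : Set (Sym2 (Fin n)))).Colorable 3) →
        ∑ q ∈ 𝓐 ×ˢ 𝓑, μ (q.1 ∪ q.2) ≤ (2 : ℝ) ^ (-((n : ℝ) / 2 * Real.logb 2 n) - (C : ℝ) * n)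

/-- **L0 (WLOG critical support).**  X1 holds iff it holds with a measure supported on 4-edge-critical edge sets,
with the same `ε` and the same `C ↦ n` schedule. -/
theorem foolingMeasure_iff_crit :
    Summit.PneNP.PneNP.Theses.AeaCutRectangles.FoolingMeasure ↔ FoolingMeasureCrit := by
  classical
  constructor
  · rintro ⟨ε, hε0, hε1, hC⟩
    refine ⟨ε, hε0, hε1, fun C => (hC C).mono fun n hn => ?_⟩
    obtain ⟨μ, h0, h1, hs, hr⟩ := hn
    have hl : ∀ S, μ S ≠ 0 → ∀ e ∈ S, ¬ e.IsDiag := fun S hS => (hs S hS).1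
    refine ⟨push μ, push_nonneg μ h0, ?_, ?_, ?_⟩
    · rw [push_total, h1]
    · intro T hT
      obtain ⟨G, rfl, hG⟩ := push_ne_zero μ hT
      exact core_critical G (hs G hG).1 (hs G hG).2
    · intro B hB1 hB2 𝓐 𝓑 h𝓐 h𝓑 hN
      calc ∑ q ∈ 𝓐 ×ˢ 𝓑, push μ (q.1 ∪ q.2)
          ≤ ∑ T ∈ dutyFinset B (bobDuty 𝓑), push μ T :=
            rect_sum_le_dutySum (push μ) (push_nonneg μ h0) 𝓐 𝓑 h𝓐 h𝓑 hN
        _ ≤ ∑ G ∈ dutyFinset B (bobDuty 𝓑), μ G := dutySum_push_le μ h0 hl B _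
        _ ≤ (2 : ℝ) ^ (-((n : ℝ) / 2 * Real.logb 2 n) - (C : ℝ) * n) :=
            dutySum_le_of_rectClause μ h0 (hr B hB1 hB2) _
  · rintro ⟨ε, hε0, hε1, hC⟩
    refine ⟨ε, hε0, hε1, fun C => (hC C).mono fun n hn => ?_⟩
    obtain ⟨μ, h0, h1, hs, hr⟩ := hn
    exact ⟨μ, h0, h1, fun S hS => ⟨(hs S hS).1, (hs S hS).2.1⟩, hr⟩

end Summit.PneNP.PneNP.Cruxes.FoolingMeasure.CriticalSupport
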